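import Summits.QuantumFields.YangMills.Theorems.SwapVirialDeficitSwapRingSharpRungGlue
import Summits.QuantumFields.YangMills.Theorems.SwapVirialDeficitLogTwistTraceConvex
import Summits.QuantumFields.YangMills.Theorems.VirialFluxGapConvexTransport
import HarnessLib

/-!
# The σ-glued ring at fixed `L`: the MEAN ACTION `⟨β𝒜⟩_{Z^S} = 9L⁴ − 1 + O(β^{−θ''})` modulo the principal sector law
# (glue (E) after (D) ✓`swap_rung_fixedL_of_principalLaw`: the fixed-`L` form of ⟨stmt-QuantumFields-24197⟩ `SwapVirialDeficit.SwapGluedStiffness`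
# modulo ONE sharp state-density law; LEAD ym-line-sfw-p2 g93's programme, LINE «sharp-sigma»; free-hands support of ⟨24197⟩)

From the fixed-`L` sharp law `|log Z^S(L,x,2L) − (12xL⁴ − (9L⁴−1)log x + C)| ≤ K·x^{−θ'}` (`x ≥ β₁`; ✓`swap_rung_fixedL_of_principalLaw` under the
principal-class state-density hypothesis), the convexity of `x ↦ log Z^S(L,x,2L)` (✓`SectorSmooth.logTwistTraceConvex`), its differentiability and
positivity (✓`swapVirialDeficit_ringTraceSmooth_proof`) and CONVEX TRANSPORT (✓`ConvexTransport.convexTransport_proof`, `D = 18L⁴ − 2`,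
`η = K(b/2)^{−θ'}` on `[b/2, 2b]`):
★★★ `swap_meanAction_fixedL_of_principalLaw` — `|b·(log Z^S)′(b) − (12bL⁴ − (9L⁴ − 1))| ≤ K''·b^{−θ'/2}` for `b ≥ β₂(L)`: the fixed-`L` mean action
of the σ-glued ring is the transverse equipartition value `9L⁴ − 1` (`18L⁴ − 2` Gaussian directions, NO logarithm) up to a power — the NUMBERS row
`⟨β𝒜⟩_{Z^S} = 9L⁴ − 1 + o(1)` of the route thesis, modulo the sharp principal law; ★★ `swap_stiffness_fixedL_of_principalLaw` — hence
`b·(log Z^S)′(b) ≤ 12bL⁴ − 9L⁴ + 3/2 − 1/4` and `12bL⁴ − 9L⁴ + 1 − 1/4 ≤ b·(log Z^S)′(b)` for `b ≥ β₃(L)`: the FIXED-`L` instance (with `c = 1/4`) of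
the crux inequality `SwapGluedStiffness`, whose content is the WINDOW-uniform version.
HONEST LABEL: fixed-`L` glue toward plan-only BC5 rungs of a DRAFT line, CONDITIONAL on the sharp principal state-density law (NOT proved here);
⟨24197⟩/⟨24194⟩/⟨24497⟩/⟨24196⟩ (window-uniform) stay OPEN; the Yang–Mills mass gap is NOT proved; no summit is proved by a line.
Width seat ym-line-sfw-p2-w2 g55 (cell ym-idea-1, free hands; own crux ⟨22884⟩ blocked-on ⟨19935⟩), `--supports stmt-QuantumFields-24197`.
THEOREMS ONLY (0 `def`, 0 `sorry`), standard axioms.  References: [cite: tHooft1979]; [cite: Luscher1983, §2]; [cite: Griffiths1964]; [cite: Vanbaal2001];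
[cite: CosteEtAl1985]; [folklore].
-/

set_option autoImplicit false

noncomputable section

open MeasureTheory Set Filter Topology
open scoped BigOperators ENNReal Nat
open Literature.MathematicalPhysics.QuantumFieldTheory hiding SU2
open Literature.MathematicalPhysics.QuantumLattice

namespace Summit.QuantumFields.YangMills.Theorems.SwapVirialDeficit.SwapRing

open Summit.QuantumFields.YangMills.Theorems.FemtoTransferGap
open Summit.QuantumFields.YangMills.Theorems.FemtoTransferGap.TT
open Summit.QuantumFields.YangMills.Theorems.VirialFluxGap.RingDeficit
open Summit.QuantumFields.YangMills.Theorems.FemtoTransferGap.TT.SectorSmooth (logTwistTraceConvex)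
open Summit.QuantumFields.YangMills.Theorems.VirialFluxGap.ConvexTransport (convexTransport_proof)

/-! ## §1 Elementary pieces -/

/-- An affine function is concave. [folklore] -/
theorem concaveOn_const_mul (a : ℝ) (ha : 0 ≤ a) (s : Set ℝ) (hs : Convex ℝ s) : ConcaveOn ℝ s (fun x : ℝ => a * x) := by
  have h := (concaveOn_id hs).smul ha
  simpa only [smul_eq_mul, id] using h

/-- `(b/2)^{−θ} = 2^{θ}·b^{−θ}` for `b > 0`. [folklore] -/
theorem half_rpow_neg {b θ : ℝ} (hb : 0 < b) : (b / 2) ^ (-θ) = (2 : ℝ) ^ θ * b ^ (-θ) := by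
  rw [Real.div_rpow hb.le (by norm_num : (0 : ℝ) ≤ 2), Real.rpow_neg (by norm_num : (0 : ℝ) ≤ 2), div_eq_mul_inv, inv_inv, mul_comm]

/-- `√(A·b^{−θ}) = √A·b^{−θ/2}` for `A ≥ 0`, `b > 0`. [folklore] -/
theorem sqrt_mul_rpow_neg {A b θ : ℝ} (hA : 0 ≤ A) (hb : 0 < b) : Real.sqrt (A * b ^ (-θ)) = Real.sqrt A * b ^ (-(θ / 2)) := by
  rw [Real.sqrt_mul hA, Real.sqrt_eq_rpow (b ^ (-θ)), ← Real.rpow_mul hb.le]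
  congr 2
  ring

/-! ## §2 The fixed-`L` mean action of the σ-glued ring, modulo the principal law -/

/-- ★★★ **`⟨β𝒜⟩_{Z^S} = 9L⁴ − 1 + O(β^{−θ''})` AT FIXED `L`, MODULO THE PRINCIPAL SECTOR LAW.**  Under the sharp state-density hypothesis for
`F^S_{000}` (✓`tauber_sandwich_rpow`'s `hvol`, verbatim), there are `K, θ'' > 0, β₂` with
`|b·(d/db) log Z^S(L,b,2L) − (12bL⁴ − (9L⁴ − 1))| ≤ K·b^{−θ''}` for all `b ≥ β₂` — ✓`swap_rung_fixedL_of_principalLaw` transported to the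
derivative by ✓`convexTransport_proof` on `[b/2, 2b]` (`D = 18L⁴ − 2`, `η = Kp(b/2)^{−θ'}`), using ✓`logTwistTraceConvex` and
✓`swapVirialDeficit_ringTraceSmooth_proof`. [cite: Griffiths1964] [cite: tHooft1979] [cite: Luscher1983, §2] [cite: CosteEtAl1985] -/
theorem swap_meanAction_fixedL_of_principalLaw (L : ℕ) [NeZero L] {v κ θ t₀ : ℝ} (hv : 0 < v) (hκ : 0 ≤ κ) (hθ : 0 < θ)
    (hθ1 : θ ≤ 1) (ht₀ : 0 < t₀)
    (hvol : ∀ t : ℝ, 0 < t → t ≤ t₀ →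
      |(ringMeasure L).real {P | swapRingDeficit L (fun _ => false) P ≤ t} / (v * t ^ (9 * L ^ 4 - 1)) - 1| ≤ κ * t ^ θ) :
    ∃ K θ'' β₂ : ℝ, 0 < θ'' ∧ ∀ b : ℝ, β₂ ≤ b →
      |b * deriv (fun x : ℝ => Real.log (TT.twistTrace L x (2 * L))) b - (12 * b * (L : ℝ) ^ 4 - (9 * (L : ℝ) ^ 4 - 1))| ≤ K * b ^ (-θ'') := by
  obtain ⟨C, K, θ', β₁, hθ', hrung⟩ := swap_rung_fixedL_of_principalLaw L hv hκ hθ hθ1 ht₀ hvol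
  obtain ⟨_, hZdiff, hpos⟩ := swapVirialDeficit_ringTraceSmooth_proof L (2 * L)
  have hZpos : ∀ x : ℝ, 0 < TT.twistTrace L x (2 * L) := fun x => (hpos x).2
  have hL : (0 : ℝ) < L := Nat.cast_pos.2 (NeZero.pos L)
  have hL1 : (1 : ℝ) ≤ L := by exact_mod_cast NeZero.one_le
  -- the transport data
  set N : ℝ := 9 * (L : ℝ) ^ 4 - 1 with hN
  set D : ℝ := 2 * N with hD
  have hN8 : 8 ≤ N := by
    have : (1 : ℝ) ≤ (L : ℝ) ^ 4 := one_le_pow₀ hL1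
    rw [hN]; linarith
  have hD0 : 0 < D := by rw [hD]; linarith
  set Kp : ℝ := max K 0 with hKp
  have hKp0 : 0 ≤ Kp := le_max_right _ _
  -- `η(b) = Kp (b/2)^{−θ'} → 0`
  have hη : Tendsto (fun b : ℝ => Kp * (b / 2) ^ (-θ')) atTop (𝓝 0) := by
    have h := ((tendsto_rpow_neg_atTop hθ').comp (tendsto_id.atTop_div_const (by norm_num : (0 : ℝ) < 2))).const_mul Kp
    rw [mul_zero] at h
    exact h
  obtain ⟨β₂, hβ₂⟩ := ((hη.eventually (Iic_mem_nhds hD0)).and ((eventually_ge_atTop (2 * β₁)).and (eventually_ge_atTop (2 : ℝ)))).exists_forall_of_atTop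
  refine ⟨8 * Real.sqrt (Kp * (2 : ℝ) ^ θ' * D), θ' / 2, β₂, by positivity, fun b hb => ?_⟩
  obtain ⟨hηD, hb1, hb2⟩ := hβ₂ b hb
  have hηD' : Kp * (b / 2) ^ (-θ') ≤ D := hηD
  have hb0 : 0 < b := by linarith
  have hb20 : 0 < b / 2 := by linarith
  -- the reduced function `f = log Z^S − 12L⁴·x`
  set f : ℝ → ℝ := fun x => Real.log (TT.twistTrace L x (2 * L)) - 12 * (L : ℝ) ^ 4 * x with hf
  have hconv : ConvexOn ℝ (Set.Icc (b / 2) (2 * b)) f :=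
    ((logTwistTraceConvex L (2 * L)).subset (Set.subset_univ _) (convex_Icc _ _)).sub
      (concaveOn_const_mul (12 * (L : ℝ) ^ 4) (by positivity) _ (convex_Icc _ _))
  have hdlog : DifferentiableAt ℝ (fun x : ℝ => Real.log (TT.twistTrace L x (2 * L))) b := (hZdiff b).log (hZpos b).ne'
  have hdlin : HasDerivAt (fun x : ℝ => 12 * (L : ℝ) ^ 4 * x) (12 * (L : ℝ) ^ 4) b := by
    simpa using (hasDerivAt_id b).const_mul (12 * (L : ℝ) ^ 4)
  have hfd : HasDerivAt f (deriv (fun x : ℝ => Real.log (TT.twistTrace L x (2 * L))) b - 12 * (L : ℝ) ^ 4) b :=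
    hdlog.hasDerivAt.sub hdlin
  have hdiff : DifferentiableAt ℝ f b := hfd.differentiableAt
  have hderiv : deriv f b = deriv (fun x : ℝ => Real.log (TT.twistTrace L x (2 * L))) b - 12 * (L : ℝ) ^ 4 := hfd.deriv
  -- the model on `[b/2, 2b]`
  have happrox : ∀ x ∈ Set.Icc (b / 2) (2 * b), |f x + D / 2 * Real.log x - C| ≤ Kp * (b / 2) ^ (-θ') := by
    intro x hx
    have hx1 : β₁ ≤ x := by linarith [hx.1]
    have hx0 : 0 < x := by linarith [hx.1]
    have h1 := hrung x hx1
    have hre : f x + D / 2 * Real.log x - C = Real.log (TT.twistTrace L x (2 * L)) - (12 * x * (L : ℝ) ^ 4 - (9 * (L : ℝ) ^ 4 - 1) * Real.log x + C) := by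
      rw [hf, hD, hN]; ring
    rw [hre]
    calc |Real.log (TT.twistTrace L x (2 * L)) - (12 * x * (L : ℝ) ^ 4 - (9 * (L : ℝ) ^ 4 - 1) * Real.log x + C)| ≤ K * x ^ (-θ') := h1
      _ ≤ Kp * x ^ (-θ') := mul_le_mul_of_nonneg_right (le_max_left _ _) (Real.rpow_nonneg hx0.le _)
      _ ≤ Kp * (b / 2) ^ (-θ') := mul_le_mul_of_nonneg_left (Real.rpow_le_rpow_of_nonpos hb20 hx.1 (by linarith)) hKp0
  -- convex transport
  have hT := convexTransport_proof f D C (Kp * (b / 2) ^ (-θ')) b hb0 hD0 (by positivity) hηD' hconv hdiff happrox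
  rw [hderiv] at hT
  -- reshape the deviation and the remainder
  have hdev : b * deriv (fun x : ℝ => Real.log (TT.twistTrace L x (2 * L))) b - (12 * b * (L : ℝ) ^ 4 - (9 * (L : ℝ) ^ 4 - 1)) =
      b * (deriv (fun x : ℝ => Real.log (TT.twistTrace L x (2 * L))) b - 12 * (L : ℝ) ^ 4) + D / 2 := by
    rw [hD, hN]; ring
  have hrem : 8 * Real.sqrt (Kp * (b / 2) ^ (-θ') * D) = 8 * Real.sqrt (Kp * (2 : ℝ) ^ θ' * D) * b ^ (-(θ' / 2)) := by
    rw [half_rpow_neg hb0, show Kp * ((2 : ℝ) ^ θ' * b ^ (-θ')) * D = Kp * (2 : ℝ) ^ θ' * D * b ^ (-θ') by ring,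
      sqrt_mul_rpow_neg (by positivity) hb0]
    ring
  rw [hdev, ← hrem]
  exact hT

/-- ★★ **THE FIXED-`L` SWAP-GLUED STIFFNESS (and softness) INEQUALITIES, modulo the principal law**: for `b ≥ β₃(L)`,
`b·(log Z^S)′(b) ≤ 12bL⁴ − 9L⁴ + 3/2 − 1/4` and `12bL⁴ − 9L⁴ + 1 − 1/4 ≤ b·(log Z^S)′(b)` — the fixed-`L` instance, with `c = 1/4`, of the crux
inequality `SwapGluedStiffness` (whose content is window-uniformity). [cite: Griffiths1964] [cite: tHooft1979] [cite: Luscher1983, §2] -/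
theorem swap_stiffness_fixedL_of_principalLaw (L : ℕ) [NeZero L] {v κ θ t₀ : ℝ} (hv : 0 < v) (hκ : 0 ≤ κ) (hθ : 0 < θ)
    (hθ1 : θ ≤ 1) (ht₀ : 0 < t₀)
    (hvol : ∀ t : ℝ, 0 < t → t ≤ t₀ →
      |(ringMeasure L).real {P | swapRingDeficit L (fun _ => false) P ≤ t} / (v * t ^ (9 * L ^ 4 - 1)) - 1| ≤ κ * t ^ θ) :
    ∃ β₃ : ℝ, ∀ b : ℝ, β₃ ≤ b →
      b * deriv (fun x : ℝ => Real.log (TT.twistTrace L x (2 * L))) b ≤ 12 * b * (L : ℝ) ^ 4 - 9 * (L : ℝ) ^ 4 + 3 / 2 - 1 / 4 ∧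
      12 * b * (L : ℝ) ^ 4 - 9 * (L : ℝ) ^ 4 + 1 - 1 / 4 ≤ b * deriv (fun x : ℝ => Real.log (TT.twistTrace L x (2 * L))) b := by
  obtain ⟨K, θ'', β₂, hθ'', h⟩ := swap_meanAction_fixedL_of_principalLaw L hv hκ hθ hθ1 ht₀ hvol
  have hK : Tendsto (fun b : ℝ => K * b ^ (-θ'')) atTop (𝓝 0) := by
    have h1 := (tendsto_rpow_neg_atTop hθ'').const_mul K
    rw [mul_zero] at h1
    exact h1
  obtain ⟨β₃, hβ₃⟩ := ((hK.eventually (Iic_mem_nhds (by norm_num : (0 : ℝ) < 1 / 4))).and (eventually_ge_atTop β₂)).exists_forall_of_atTop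
  refine ⟨β₃, fun b hb => ?_⟩
  obtain ⟨hsmall, hb2⟩ := hβ₃ b hb
  have hsmall' : K * b ^ (-θ'') ≤ 1 / 4 := hsmall
  have hab := abs_le.1 ((h b hb2).trans hsmall')
  constructor <;> linarith [hab.1, hab.2]

end Summit.QuantumFields.YangMills.Theorems.SwapVirialDeficit.SwapRing

end
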